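import Summits.AtomisticToContinuum.Crystallization.Theorems.FreeSplittingCertificatesRadiusLadderPacking

/-!
# Joint multi-shell certificates — far shell sum beyond `K r` (`FiniteRangeSplitting`, stmt-AtomisticToContinuum-12559)

Support lemma for the next rung of the `FreeSplittingCertificates` radius ladder (block-2b unit `b2b-freesplit-A`, gen 40).
VALUE = the far-field tail of a joint multi-shell certificate, with the threshold `4r` of the tree's
`sum_inv_pow_six_far_le` replaced by a general `K r` — NOT summit progress.

In an `r`-separated configuration the points at distance `≥ K r` (`K ≥ 1` an integer) from `xᵢ` satisfy
`∑ |xᵢ − x_k|⁻⁶ ≤ 2 (2K+3)³ / K⁵ · r⁻⁶`: shell `⌊|xᵢ − x_k|/r⌋ = b ≥ K` holds `≤ (2b+3)³ ≤ ((2K+3)/K)³ b³` points, each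
contributing `≤ (b r)⁻⁶`, `b⁻³ ≤ b⁻²/K`, and `∑_{b ≥ K} b⁻² ≤ 2/K`.  (`K = 4` is the tree's constant `1331/512`;
`K = 12` gives `729/4608`.)
-/

noncomputable section
namespace Summit.AtomisticToContinuum.Crystallization.Theorems.StrictSplittingRuleBirth

open scoped BigOperators Classical
open Literature.MathematicalPhysics.StatisticalMechanics

/-- **Far shell sum beyond `K r`.**  In an `r`-separated configuration (`r > 0`, `K ≥ 1`), the points at distance
`≥ K r` from `xᵢ` have `∑ |xᵢ − x_k|⁻⁶ ≤ 2 (2K+3)³ / K⁵ · r⁻⁶`. [folklore] -/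
theorem sum_inv_pow_six_far_le_of_le {N : ℕ} (x : Fin N → EuclideanSpace ℝ (Fin 3)) {r : ℝ} (hr : 0 < r)
    (hsep : ∀ k l, k ≠ l → r ≤ dist (x k) (x l)) (i : Fin N) (K : ℕ) (hK : 1 ≤ K) :
    ∑ k ∈ (Finset.univ.erase i).filter (fun k => (K : ℝ) * r ≤ dist (x i) (x k)), (dist (x i) (x k))⁻¹ ^ 6 ≤
      2 * (2 * (K : ℝ) + 3) ^ 3 / (K : ℝ) ^ 5 * r⁻¹ ^ 6 := by
  set s := (Finset.univ.erase i).filter (fun k => (K : ℝ) * r ≤ dist (x i) (x k)) with hs_def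
  set m : Fin N → ℕ := fun k => ⌊dist (x i) (x k) / r⌋₊ with hm
  set t := s.image m with ht_def
  have hKpos : (0 : ℝ) < K := by exact_mod_cast hK
  have hmem : ∀ k ∈ s, m k ∈ t := fun k hk => Finset.mem_image_of_mem m hk
  have hks : ∀ k ∈ s, (K : ℝ) * r ≤ dist (x i) (x k) := fun k hk => (Finset.mem_filter.1 hk).2
  have hmK : ∀ k ∈ s, K ≤ m k := fun k hk => by
    have h4 : (K : ℝ) ≤ dist (x i) (x k) / r := by rw [le_div_iff₀ hr]; exact hks k hk
    have := Nat.floor_le_floor h4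
    simpa using this
  have hm1 : ∀ k ∈ s, 1 ≤ m k := fun k hk => le_trans hK (hmK k hk)
  have hmle : ∀ k ∈ s, r * m k ≤ dist (x i) (x k) := fun k hk => by
    have := Nat.floor_le (div_nonneg dist_nonneg hr.le : 0 ≤ dist (x i) (x k) / r)
    rwa [le_div_iff₀ hr, mul_comm] at this
  have hmlt : ∀ k ∈ s, dist (x i) (x k) < (m k + 1) * r := fun k hk => by
    have := Nat.lt_floor_add_one (dist (x i) (x k) / r)
    rwa [div_lt_iff₀ hr] at this
  -- termwise: `|xᵢ - x_k|⁻⁶ ≤ (r m_k)⁻⁶`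
  have step1 : ∑ k ∈ s, (dist (x i) (x k))⁻¹ ^ 6 ≤ ∑ k ∈ s, r⁻¹ ^ 6 * ((m k : ℝ))⁻¹ ^ 6 := by
    refine Finset.sum_le_sum fun k hk => ?_
    rw [← mul_pow, ← mul_inv]
    have h0 : 0 < r * m k := mul_pos hr (by exact_mod_cast hm1 k hk)
    exact pow_le_pow_left₀ (inv_nonneg.2 dist_nonneg) (inv_anti₀ h0 (hmle k hk)) _
  -- regroup by shells
  have step2 : ∑ k ∈ s, r⁻¹ ^ 6 * ((m k : ℝ))⁻¹ ^ 6 =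
      ∑ b ∈ t, ((s.filter fun k => m k = b).card : ℝ) * (r⁻¹ ^ 6 * ((b : ℝ))⁻¹ ^ 6) := by
    have := Finset.sum_fiberwise_of_maps_to' hmem (fun b : ℕ => r⁻¹ ^ 6 * ((b : ℝ))⁻¹ ^ 6)
    simp only [Finset.sum_const, nsmul_eq_mul] at this
    exact this.symm
  -- each shell holds at most `(2b+3)³` particles
  have step3 : ∀ b ∈ t, ((s.filter fun k => m k = b).card : ℝ) ≤ (2 * (b : ℝ) + 3) ^ 3 := by
    intro b hb
    set F := s.filter fun k => m k = b with hF
    have hinj : Set.InjOn x F := fun k _ l _ hkl => by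
      by_contra hne
      have := hsep k l hne
      rw [hkl, dist_self] at this
      exact absurd this (not_le.2 hr)
    rw [← Finset.card_image_of_injOn hinj]
    have hR : (0 : ℝ) ≤ ((b : ℝ) + 1) * r := by positivity
    have := card_le_of_separated_of_dist_le (F.image x) (x i) hr hR ?_ ?_
    · rw [finrank_euclideanSpace_fin] at this
      convert this using 2
      field_simp
      ring
    · intro c hc
      obtain ⟨k, hk, rfl⟩ := Finset.mem_image.1 hc
      obtain ⟨hks', hkb⟩ := Finset.mem_filter.1 hk
      rw [dist_comm]
      have := hmlt k hks'
      rw [hkb] at this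
      exact this.le
    · intro c hc c' hc' hne
      obtain ⟨k, -, rfl⟩ := Finset.mem_image.1 hc
      obtain ⟨l, -, rfl⟩ := Finset.mem_image.1 hc'
      exact hsep k l fun h => hne (h ▸ rfl)
  -- numerics per shell: `(2b+3)³ b⁻⁶ ≤ ((2K+3)³/K⁴) b⁻²` for `b ≥ K`
  have step4 : ∀ b ∈ t, (2 * (b : ℝ) + 3) ^ 3 * (r⁻¹ ^ 6 * ((b : ℝ))⁻¹ ^ 6) ≤
      (2 * (K : ℝ) + 3) ^ 3 / (K : ℝ) ^ 4 * r⁻¹ ^ 6 * ((b : ℝ) ^ 2)⁻¹ := by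
    intro b hb
    obtain ⟨k, hk, rfl⟩ := Finset.mem_image.1 hb
    have hbK : (K : ℝ) ≤ (m k : ℝ) := by exact_mod_cast hmK k hk
    set β : ℝ := (m k : ℝ)
    have hβ : 0 < β := lt_of_lt_of_le hKpos hbK
    have hr6 : 0 < r⁻¹ ^ 6 := by positivity
    -- (2β+3) ≤ ((2K+3)/K) β  and  β³ · K ≤ β⁴
    have h5 : 2 * β + 3 ≤ (2 * (K : ℝ) + 3) / K * β := by
      rw [div_mul_eq_mul_div, le_div_iff₀ hKpos]; nlinarith
    have h5' : (2 * β + 3) ^ 3 ≤ ((2 * (K : ℝ) + 3) / K * β) ^ 3 := pow_le_pow_left₀ (by positivity) h5 3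
    have key : (2 * β + 3) ^ 3 * (β⁻¹) ^ 6 ≤ (2 * (K : ℝ) + 3) ^ 3 / (K : ℝ) ^ 4 * (β ^ 2)⁻¹ := by
      have e1 : ((2 * (K : ℝ) + 3) / K * β) ^ 3 * (β⁻¹) ^ 6 = (2 * (K : ℝ) + 3) ^ 3 / (K : ℝ) ^ 3 * (β ^ 3)⁻¹ := by
        field_simp
      have e2 : (2 * (K : ℝ) + 3) ^ 3 / (K : ℝ) ^ 4 * (β ^ 2)⁻¹ = (2 * (K : ℝ) + 3) ^ 3 / (K : ℝ) ^ 3 * ((K : ℝ) * β ^ 2)⁻¹ := by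
        field_simp
      calc (2 * β + 3) ^ 3 * (β⁻¹) ^ 6 ≤ ((2 * (K : ℝ) + 3) / K * β) ^ 3 * (β⁻¹) ^ 6 :=
            mul_le_mul_of_nonneg_right h5' (by positivity)
        _ = (2 * (K : ℝ) + 3) ^ 3 / (K : ℝ) ^ 3 * (β ^ 3)⁻¹ := e1
        _ ≤ (2 * (K : ℝ) + 3) ^ 3 / (K : ℝ) ^ 3 * ((K : ℝ) * β ^ 2)⁻¹ := by
            refine mul_le_mul_of_nonneg_left ?_ (by positivity)
            exact inv_anti₀ (by positivity) (by nlinarith [sq_nonneg β])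
        _ = (2 * (K : ℝ) + 3) ^ 3 / (K : ℝ) ^ 4 * (β ^ 2)⁻¹ := e2.symm
    calc (2 * β + 3) ^ 3 * (r⁻¹ ^ 6 * (β⁻¹) ^ 6) = r⁻¹ ^ 6 * ((2 * β + 3) ^ 3 * (β⁻¹) ^ 6) := by ring
      _ ≤ r⁻¹ ^ 6 * ((2 * (K : ℝ) + 3) ^ 3 / (K : ℝ) ^ 4 * (β ^ 2)⁻¹) := mul_le_mul_of_nonneg_left key hr6.le
      _ = (2 * (K : ℝ) + 3) ^ 3 / (K : ℝ) ^ 4 * r⁻¹ ^ 6 * (β ^ 2)⁻¹ := by ring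
  -- `∑_{b ∈ t} b⁻² ≤ 2/K` (all `b ≥ K`)
  have step5 : ∑ b ∈ t, ((b : ℝ) ^ 2)⁻¹ ≤ 2 / K := by
    have hsub : t ⊆ Finset.Ioo (K - 1) (t.sup id + 1) := fun b hb => by
      rw [Finset.mem_Ioo]
      obtain ⟨k, hk, rfl⟩ := Finset.mem_image.1 hb
      exact ⟨by have := hmK k hk; omega, Nat.lt_succ_of_le (Finset.le_sup (f := id) hb)⟩
    have h2 := sum_Ioo_inv_sq_le (α := ℝ) (K - 1) (t.sup id + 1)
    have hK' : ((K - 1 : ℕ) : ℝ) + 1 = K := by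
      rw [Nat.cast_sub hK]; push_cast; ring
    calc ∑ b ∈ t, ((b : ℝ) ^ 2)⁻¹ ≤ ∑ b ∈ Finset.Ioo (K - 1) (t.sup id + 1), ((b : ℝ) ^ 2)⁻¹ :=
          Finset.sum_le_sum_of_subset_of_nonneg hsub fun b _ _ => by positivity
      _ ≤ 2 / (((K - 1 : ℕ) : ℝ) + 1) := by exact_mod_cast h2
      _ = 2 / K := by rw [hK']
  have hr6 : 0 ≤ r⁻¹ ^ 6 := by positivity
  have hc : 0 ≤ (2 * (K : ℝ) + 3) ^ 3 / (K : ℝ) ^ 4 * r⁻¹ ^ 6 := by positivity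
  calc ∑ k ∈ s, (dist (x i) (x k))⁻¹ ^ 6
      ≤ ∑ b ∈ t, ((s.filter fun k => m k = b).card : ℝ) * (r⁻¹ ^ 6 * ((b : ℝ))⁻¹ ^ 6) :=
        step1.trans_eq step2
    _ ≤ ∑ b ∈ t, (2 * (b : ℝ) + 3) ^ 3 * (r⁻¹ ^ 6 * ((b : ℝ))⁻¹ ^ 6) :=
        Finset.sum_le_sum fun b hb => mul_le_mul_of_nonneg_right (step3 b hb) (by positivity)
    _ ≤ ∑ b ∈ t, (2 * (K : ℝ) + 3) ^ 3 / (K : ℝ) ^ 4 * r⁻¹ ^ 6 * ((b : ℝ) ^ 2)⁻¹ := Finset.sum_le_sum step4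
    _ = (2 * (K : ℝ) + 3) ^ 3 / (K : ℝ) ^ 4 * r⁻¹ ^ 6 * ∑ b ∈ t, ((b : ℝ) ^ 2)⁻¹ := by rw [Finset.mul_sum]
    _ ≤ (2 * (K : ℝ) + 3) ^ 3 / (K : ℝ) ^ 4 * r⁻¹ ^ 6 * (2 / K) := mul_le_mul_of_nonneg_left step5 hc
    _ = 2 * (2 * (K : ℝ) + 3) ^ 3 / (K : ℝ) ^ 5 * r⁻¹ ^ 6 := by
        field_simp

/-- The `K = 12` instance used by the `δ`-axis certificates: `∑_{|xᵢ − x_k| ≥ 12 r} |xᵢ − x_k|⁻⁶ ≤ (729/4608) r⁻⁶`. -/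
theorem sum_inv_pow_six_far12_le {N : ℕ} (x : Fin N → EuclideanSpace ℝ (Fin 3)) {r : ℝ} (hr : 0 < r)
    (hsep : ∀ k l, k ≠ l → r ≤ dist (x k) (x l)) (i : Fin N) :
    ∑ k ∈ (Finset.univ.erase i).filter (fun k => 12 * r ≤ dist (x i) (x k)), (dist (x i) (x k))⁻¹ ^ 6 ≤
      729 / 4608 * r⁻¹ ^ 6 := by
  have h := sum_inv_pow_six_far_le_of_le x hr hsep i 12 (by norm_num)
  have e : (2 : ℝ) * (2 * ((12 : ℕ) : ℝ) + 3) ^ 3 / ((12 : ℕ) : ℝ) ^ 5 = 729 / 4608 := by norm_num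
  rw [e] at h
  convert h using 4
  push_cast
  ring

end Summit.AtomisticToContinuum.Crystallization.Theorems.StrictSplittingRuleBirth

end
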